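import Mathlib
import HarnessLib
import Summits.Ventures.LatticeQCDFlow.Exactness.SUNSpectralPlaquetteLayerEquiv
import Summits.Ventures.LatticeQCDFlow.Exactness.SpectralCouplingGaugeEquivariance
import Summits.Ventures.LatticeQCDFlow.Exactness.EquivariantJacobianGaugeInvariance

/-!
# Exact Jacobians of the `SU(N)` spectral PLAQUETTE coupling layer are class functions: almost everywhere for measurable ones, everywhere for continuous ones

HONEST FRAMING: exact (Metropolis-corrected) sampling algorithms for lattice gauge theory;
figures of merit are autocorrelation/cost numbers at stated couplings and volumes; no
continuum-physics claim.

Venture `LatticeQCDFlow` (cell pub-lqcd), topic `Exactness`; FANOUT row 10 (`eng-equiv`, engine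
`latflow.equiv` `spectral.SUNSpectralCoupling` under the direction masks; Boyda et al., PRD 103 (2021)
074504 §III.C, named only; the engine's unit test "log-det gauge invariance 1.1e-14" for the spectral
layers).  NEW WORK of the cell over three tree modules: the layer as a measurable automorphism when the
per-link eigenvalue flows are invertible (`SUNSpectralPlaquetteLayerEquiv`), its gauge EQUIVARIANCE for
gauge-invariant eigenvalue-map fields (`SpectralCouplingGaugeEquivariance`), and the general principles
of `EquivariantJacobianGaugeInvariance` (a measurable exact Jacobian of an equivariant automorphism of
`G^E` is gauge invariant a.e.; a continuous one everywhere).  The booked spectral Jacobians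
(`JD(spectrum)·|Δ'|²/|Δ|²`) are measurable but jump at the alcove walls, hence the a.e. form is the one
that applies to them; no Jacobian is constructed here and nothing of `SpectralDensityMeasurable` is used.
Nothing is cited as a fact; no number; no definition.

* `isGaugeEquivariant_spectralPlaquetteLayer_frozen` — the layer `V e ↦ hol V e (P) P⁻¹ V e` whose
  kernel field reads the FROZEN links (`hol V e = h e (V|frozen)`), follows the spectral recipe of
  eigenvalue maps `f e y`, and whose eigenvalue maps are gauge invariant in the frozen context
  (`f e (V^g|frozen) = f e (V|frozen)`), is `IsGaugeEquivariant`;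
* **`ae_isGaugeInvariant_jacobian_spectralPlaquetteLayer_sun`** — with invertible eigenvalue flows
  (two-sided inverses `g e y` realised by kernels `h' e y`, joint continuity), EVERY measurable exact
  Jacobian `J` of the layer for `⊗_e Haar_{SU(n)}` satisfies `J(U^g) = J(U)` for a.e. `U`, every `g`;
* **`isGaugeInvariant_jacobian_spectralPlaquetteLayer_sun`** — and every CONTINUOUS exact Jacobian
  `j ≥ 0` is a class function.
-/

noncomputable section

namespace Summit.Ventures.LatticeQCDFlow.Exactness

open Matrix MeasureTheory
open Literature.LinearAlgebra.Matrix
open Literature.MathematicalPhysics.QuantumFieldTheory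
open scoped ENNReal

variable {n : Type*} [Fintype n] [DecidableEq n] {d L : ℕ} [NeZero L]
  (p : Edge d L → Prop) [DecidablePred p] (ν : Edge d L → Fin d)
  (h1 : ∀ e, p e → ¬p (e.1.shift e.2, ν e)) (h2 : ∀ e, p e → ¬p (e.1.shift (ν e), e.2))
  (h3 : ∀ e, p e → ¬p (e.1, ν e))
  (hol : GaugeConfig d L (Matrix.specialUnitaryGroup n ℂ) → Edge d L →
    Matrix.specialUnitaryGroup n ℂ → Matrix.specialUnitaryGroup n ℂ)
  (h h' : Edge d L → ({f : Edge d L // ¬p f} → Matrix.specialUnitaryGroup n ℂ) →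
    Matrix.specialUnitaryGroup n ℂ → Matrix.specialUnitaryGroup n ℂ)
  (hHV : ∀ V e, p e → hol V e = h e (fun f => V f))
  (f g : Edge d L → ({f : Edge d L // ¬p f} → Matrix.specialUnitaryGroup n ℂ) → (n → ℂ) → (n → ℂ))
  (hf : ∀ e, ContinuousOn
    (fun q : ({f : Edge d L // ¬p f} → Matrix.specialUnitaryGroup n ℂ) × (n → ℂ) => f e q.1 q.2)
    {q | ∀ i, ‖q.2 i‖ = 1})
  (hagree : ∀ e y (P : Matrix.specialUnitaryGroup n ℂ) (V : Matrix n n ℂ) (dg : n → ℂ),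
    V ∈ Matrix.unitaryGroup n ℂ → (P : Matrix n n ℂ) = V * diagonal dg * star V →
      ((h e y P : Matrix.specialUnitaryGroup n ℂ) : Matrix n n ℂ) = V * diagonal (f e y dg) * star V)
  (hagree' : ∀ e y (P : Matrix.specialUnitaryGroup n ℂ) (V : Matrix n n ℂ) (dg : n → ℂ),
    V ∈ Matrix.unitaryGroup n ℂ → (P : Matrix n n ℂ) = V * diagonal dg * star V →
      ((h' e y P : Matrix.specialUnitaryGroup n ℂ) : Matrix n n ℂ) = V * diagonal (g e y dg) * star V)
  (hgf : ∀ e y (dg : n → ℂ), (∀ i, ‖dg i‖ = 1) → ∏ i, dg i = 1 → g e y (f e y dg) = dg)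
  (hfg : ∀ e y (dg : n → ℂ), (∀ i, ‖dg i‖ = 1) → ∏ i, dg i = 1 → f e y (g e y dg) = dg)
  (hfinv : ∀ (gt : Site d L → Matrix.specialUnitaryGroup n ℂ)
    (V : GaugeConfig d L (Matrix.specialUnitaryGroup n ℂ)) (e : Edge d L), p e →
      f e (fun q => gaugeTransform gt V q) = f e (fun q => V q))

include hHV hagree hfinv

omit [NeZero L] in
/-- **The spectral plaquette coupling layer with a frozen-context kernel field and gauge-invariant
eigenvalue maps is gauge equivariant** (`SpectralCouplingGaugeEquivariance.isGaugeEquivariant_spectralCouplingLayer`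
read through `hol V e = h e (V|frozen)`). -/
theorem isGaugeEquivariant_spectralPlaquetteLayer_frozen :
    IsGaugeEquivariant (fun (V : GaugeConfig d L (Matrix.specialUnitaryGroup n ℂ)) (e : Edge d L) =>
      if p e then hol V e (plaquetteHolonomy V e.1 e.2 (ν e)) * (plaquetteHolonomy V e.1 e.2 (ν e))⁻¹ * V e
      else V e) := by
  refine isGaugeEquivariant_spectralCouplingLayer p ν (fun V e => f e (fun q => V q)) hol ?_ ?_
  · intro V e P W c he hW hP
    rw [hHV V e he]
    exact hagree e _ P W c hW hP
  · intro gt V e he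
    exact hfinv gt V e he

include h1 h2 h3 hf hagree' hgf hfg

/-- **Every measurable exact Jacobian of the `SU(N)` spectral plaquette coupling layer is gauge
invariant almost everywhere** (invertible eigenvalue flows; product Haar). -/
theorem ae_isGaugeInvariant_jacobian_spectralPlaquetteLayer_sun
    {J : GaugeConfig d L (Matrix.specialUnitaryGroup n ℂ) → ℝ≥0∞}
    (hJ : HasJacobian (Measure.pi fun _ : Edge d L => haarProbability (Matrix.specialUnitaryGroup n ℂ))
      (fun (V : GaugeConfig d L (Matrix.specialUnitaryGroup n ℂ)) (e : Edge d L) =>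
        if p e then hol V e (plaquetteHolonomy V e.1 e.2 (ν e)) * (plaquetteHolonomy V e.1 e.2 (ν e))⁻¹ * V e
        else V e) J)
    (gt : Site d L → Matrix.specialUnitaryGroup n ℂ) :
    ∀ᵐ U ∂(Measure.pi fun _ : Edge d L => haarProbability (Matrix.specialUnitaryGroup n ℂ)),
      J (gaugeTransform gt U) = J U := by
  obtain ⟨Ψ, hΨ⟩ := exists_measurableEquiv_spectralPlaquetteLayer_sun p ν h1 h2 h3 hol h h' hHV f g hf hagree
    hagree' hgf hfg
  have hequiv : IsGaugeEquivariant (Ψ : GaugeConfig d L (Matrix.specialUnitaryGroup n ℂ) →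
      GaugeConfig d L (Matrix.specialUnitaryGroup n ℂ)) := by
    rw [hΨ]
    exact isGaugeEquivariant_spectralPlaquetteLayer_frozen p ν hol h hHV f hagree hfinv
  rw [← hΨ] at hJ
  exact ae_gaugeInvariant_of_hasJacobian hequiv hJ gt

/-- **Every continuous exact Jacobian of the `SU(N)` spectral plaquette coupling layer is a class
function.** -/
theorem isGaugeInvariant_jacobian_spectralPlaquetteLayer_sun
    {j : GaugeConfig d L (Matrix.specialUnitaryGroup n ℂ) → ℝ} (hj : Continuous j) (hj0 : ∀ U, 0 ≤ j U)
    (hJ : HasJacobian (Measure.pi fun _ : Edge d L => haarProbability (Matrix.specialUnitaryGroup n ℂ))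
      (fun (V : GaugeConfig d L (Matrix.specialUnitaryGroup n ℂ)) (e : Edge d L) =>
        if p e then hol V e (plaquetteHolonomy V e.1 e.2 (ν e)) * (plaquetteHolonomy V e.1 e.2 (ν e))⁻¹ * V e
        else V e) (fun U => ENNReal.ofReal (j U))) :
    IsGaugeInvariant j := by
  haveI : SecondCountableTopology (Matrix n n ℂ) := inferInstanceAs (SecondCountableTopology (n → n → ℂ))
  haveI : SecondCountableTopology (Matrix.specialUnitaryGroup n ℂ) :=
    Topology.IsEmbedding.subtypeVal.secondCountableTopology
  obtain ⟨Ψ, hΨ⟩ := exists_measurableEquiv_spectralPlaquetteLayer_sun p ν h1 h2 h3 hol h h' hHV f g hf hagree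
    hagree' hgf hfg
  have hequiv : IsGaugeEquivariant (Ψ : GaugeConfig d L (Matrix.specialUnitaryGroup n ℂ) →
      GaugeConfig d L (Matrix.specialUnitaryGroup n ℂ)) := by
    rw [hΨ]
    exact isGaugeEquivariant_spectralPlaquetteLayer_frozen p ν hol h hHV f hagree hfinv
  rw [← hΨ] at hJ
  exact isGaugeInvariant_of_hasJacobian hequiv hj hj0 hJ

end Summit.Ventures.LatticeQCDFlow.Exactness

end
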